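import Summits.ValiantsHypothesis.ValiantsHypothesis.Theorems.MonotoneRestorationOrbitRestorationQPWaringJennrichAffine
import HarnessLib

/-!
# Identifiable Waring expressions are orbit-restorable (the plug-in form of the A_∞ mechanism)

Route MonotoneRestoration, crux `OrbitRestorationQP` (stmt-ValiantsHypothesis-18293), line `depth-three-rung`,
stub A_∞ `stub_sigmaPiSigmaValue`.  Namespace `Summit.ValiantsHypothesis.ValiantsHypothesis.Theorems.WaringJennrich`.

`…WaringJennrichAffine.lean` proves: invariant + (Jennrich-)identifiable ⇒ small orbits ⇒ restorable.  This
file isolates the mechanism from the identifiability CRITERION, so that further criteria (Sylvester's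
low-rank/high-degree uniqueness, Kruskal-type uniqueness, …) plug in without touching the group-theoretic and
circuit side:

* `orbit_aff_subset_of_identifiable` / `ncard_orbit_aff_le_of_identifiable` — if the affine Waring
  expression `f = Σ_{i<r} a_i (ℓ_{w_i} + b_i)^d` (`a_i ≠ 0`, `d ≥ 1`) is IDENTIFIABLE ALONG THE GROUP in
  the weak sense "whenever the permuted representation `Σ_j a_j (ℓ_{σ·w_j} + b_j)^d` equals `f`, each of
  its forms is `c (ℓ_{w_k} + b_k)` with `a_j c^d = a_k`", and `f` is diagonally `Sym(Fin n)`-invariant,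
  then every form has at most `r·d` images;
* `qpOrbitRestorable_of_identifiableWaring` — hence `QPOrbitRestorable (c+5) n f` when
  `r·d ≤ 2^((log₂ n + c)^c)`;
* `identifiable_of_linearIndependent` — the Jennrich stratum satisfies the identifiability hypothesis
  (so `qpOrbitRestorable_of_independentAffineWaring` is an instance).

Honest label: mechanism only; A_∞ stays open exactly at NON-identifiable symmetric families. [folklore]
-/

noncomputable section

open scoped Classical

-- `Summit.ValiantsHypothesis.ValiantsHypothesis.…` is the tree's single-conjunct layout (Sub = Summit).
set_option linter.dupNamespace false

namespace Summit.ValiantsHypothesis.ValiantsHypothesis.Theorems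

namespace WaringJennrich

open MvPolynomial Finset OrbitRestorationQPDepthThreeRung

variable {n r d : ℕ} (w : Fin r → (Fin n × Fin n) → ℂ) (b a : Fin r → ℂ)

/-- **Identifiable + invariant ⇒ explicit finite orbits of the forms.** [folklore] -/
theorem orbit_aff_subset_of_identifiable (hd : 1 ≤ d) (ha : ∀ i, a i ≠ 0)
    (hid : ∀ σ : Equiv.Perm (Fin n),
      ∑ i, C (a i) * (lin (w i) + C (b i)) ^ d =
          ∑ j, C (a j) * (lin (fun x => w j (σ⁻¹ • x)) + C (b j)) ^ d →
        ∀ j, ∃ (k : Fin r) (c : ℂ),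
          lin (fun x => w j (σ⁻¹ • x)) + C (b j) = C c * (lin (w k) + C (b k)) ∧ a j * c ^ d = a k)
    (hfix : ∀ σ : Equiv.Perm (Fin n), ren σ (∑ i, C (a i) * (lin (w i) + C (b i)) ^ d) =
      ∑ i, C (a i) * (lin (w i) + C (b i)) ^ d) (j : Fin r) :
    (Set.range fun σ : Equiv.Perm (Fin n) => ren σ (lin (w j) + C (b j))) ⊆
      ↑((Finset.univ : Finset (Fin r)).biUnion fun k =>
        ((Polynomial.nthRoots d (a k / a j)).toFinset.image fun c => C c * (lin (w k) + C (b k)))) := by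
  rintro _ ⟨σ, rfl⟩
  have h := hfix σ
  simp only [map_sum, map_mul, ren_C, map_pow, ren_aff] at h
  obtain ⟨k, c, hkc, hcoef⟩ := hid σ h.symm j
  simp only [Finset.coe_biUnion, Finset.coe_univ, Set.mem_univ, Set.iUnion_true, Set.mem_iUnion,
    Finset.coe_image, Set.mem_image, Finset.mem_coe, Multiset.mem_toFinset]
  refine ⟨k, c, ?_, ?_⟩
  · rw [Polynomial.mem_nthRoots (by omega), eq_div_iff (ha j), mul_comm]
    exact hcoef
  · rw [ren_aff, hkc]

/-- **Orbit bound from identifiability**: at most `r · d` images per form. [folklore] -/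
theorem ncard_orbit_aff_le_of_identifiable (hd : 1 ≤ d) (ha : ∀ i, a i ≠ 0)
    (hid : ∀ σ : Equiv.Perm (Fin n),
      ∑ i, C (a i) * (lin (w i) + C (b i)) ^ d =
          ∑ j, C (a j) * (lin (fun x => w j (σ⁻¹ • x)) + C (b j)) ^ d →
        ∀ j, ∃ (k : Fin r) (c : ℂ),
          lin (fun x => w j (σ⁻¹ • x)) + C (b j) = C c * (lin (w k) + C (b k)) ∧ a j * c ^ d = a k)
    (hfix : ∀ σ : Equiv.Perm (Fin n), ren σ (∑ i, C (a i) * (lin (w i) + C (b i)) ^ d) =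
      ∑ i, C (a i) * (lin (w i) + C (b i)) ^ d) (j : Fin r) :
    (Set.range fun σ : Equiv.Perm (Fin n) => ren σ (lin (w j) + C (b j))).ncard ≤ r * d := by
  refine (Set.ncard_le_ncard (orbit_aff_subset_of_identifiable w b a hd ha hid hfix j)
    (Finset.finite_toSet _)).trans ?_
  rw [Set.ncard_coe_finset]
  refine (Finset.card_biUnion_le).trans ?_
  calc ∑ k : Fin r, ((Polynomial.nthRoots d (a k / a j)).toFinset.image
        fun c => C c * (lin (w k) + C (b k))).card
      ≤ ∑ _k : Fin r, d := Finset.sum_le_sum fun k _ =>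
        Finset.card_image_le.trans ((Multiset.toFinset_card_le _).trans (Polynomial.card_nthRoots _ _))
    _ = r * d := by rw [Finset.sum_const, Finset.card_univ, Fintype.card_fin, smul_eq_mul]

/-- **IDENTIFIABLE INVARIANT WARING EXPRESSIONS ARE ORBIT-RESTORABLE** (the mechanism of A_∞ beyond rank
bounds, workfile §9, as a plug-in statement): a diagonally `Sym(Fin n)`-invariant
`f = Σ_{i<r} a_i (ℓ_{w_i} + b_i)^d` (`a_i ≠ 0`, `d ≥ 1`) that is identifiable in the weak sense above, with
`r·d ≤ 2^((log₂ n + c)^c)`, is `QPOrbitRestorable (c+5) n f`. [folklore] -/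
theorem qpOrbitRestorable_of_identifiableWaring {c : ℕ} (hd : 1 ≤ d) (ha : ∀ i, a i ≠ 0)
    (hid : ∀ σ : Equiv.Perm (Fin n),
      ∑ i, C (a i) * (lin (w i) + C (b i)) ^ d =
          ∑ j, C (a j) * (lin (fun x => w j (σ⁻¹ • x)) + C (b j)) ^ d →
        ∀ j, ∃ (k : Fin r) (c : ℂ),
          lin (fun x => w j (σ⁻¹ • x)) + C (b j) = C c * (lin (w k) + C (b k)) ∧ a j * c ^ d = a k)
    (hB : r * d ≤ 2 ^ ((Nat.log 2 n + c) ^ c)) {f : MvPolynomial (Fin n × Fin n) ℂ}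
    (hf : f = ∑ i, C (a i) * (lin (w i) + C (b i)) ^ d) (hfix : ∀ σ : Equiv.Perm (Fin n), ren σ f = f) :
    QPOrbitRestorable (c + 5) n f := by
  have hfix' : ∀ σ : Equiv.Perm (Fin n), ren σ (∑ i, C (a i) * (lin (w i) + C (b i)) ^ d) =
      ∑ i, C (a i) * (lin (w i) + C (b i)) ^ d := by
    intro σ; rw [← hf]; exact hfix σ
  have horb := ncard_orbit_aff_le_of_identifiable w b a hd ha hid hfix'
  refine ValueProducts.qpOrbitRestorable_of_affineProductTerms (τ := Fin r) (ι := Fin d)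
    (fun s _ => b s) (fun s _ => w s) a (fun s i => ?_) (fun s => ?_) ?_ hfix
  · rw [affineForm_eq_aff]
    exact (horb s).trans hB
  · have hfac : ∀ σ : Equiv.Perm (Fin n),
        ((Finset.univ : Finset (Fin d)).val.map
          (ValueProducts.affineForm (fun s _ => b s) (fun s _ => w s) s)).map (ren σ) =
        (Finset.univ : Finset (Fin d)).val.map (fun _ => ren σ (lin (w s) + C (b s))) := by
      intro σ
      rw [Multiset.map_map]
      refine Multiset.map_congr rfl fun i _ => ?_
      simp only [Function.comp_apply, affineForm_eq_aff]
    refine (TermCircuit.ncard_range_le_of_factor _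
      (fun σ : Equiv.Perm (Fin n) => ren σ (lin (w s) + C (b s)))
      (fun q => (Finset.univ : Finset (Fin d)).val.map fun _ => q) hfac).trans ?_
    exact (horb s).trans hB
  · rw [hf]
    refine Finset.sum_congr rfl fun s _ => ?_
    rw [Finset.prod_congr rfl fun i _ => affineForm_eq_aff w b s i, Finset.prod_const, Finset.card_univ,
      Fintype.card_fin]

/-- **The Jennrich stratum is identifiable along the group**: linearly independent linear parts and
`d ≥ 3` give the hypothesis `hid` of `qpOrbitRestorable_of_identifiableWaring` (independence is transported
along `σ` by `linearIndependent_perm`), so `qpOrbitRestorable_of_independentAffineWaring` is an instance of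
the plug-in statement. [folklore] -/
theorem identifiable_of_linearIndependent (hd : 3 ≤ d) (hw : LinearIndependent ℂ w) (ha : ∀ i, a i ≠ 0)
    (σ : Equiv.Perm (Fin n))
    (h : ∑ i, C (a i) * (lin (w i) + C (b i)) ^ d =
      ∑ j, C (a j) * (lin (fun x => w j (σ⁻¹ • x)) + C (b j)) ^ d) (j : Fin r) :
    ∃ (k : Fin r) (c : ℂ),
      lin (fun x => w j (σ⁻¹ • x)) + C (b j) = C c * (lin (w k) + C (b k)) ∧ a j * c ^ d = a k := by
  obtain ⟨k, c, -, hkc, hcoef⟩ := jennrich_affine_terms w b a (fun i => fun x => w i (σ⁻¹ • x)) b a hw ha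
    hd le_rfl (linearIndependent_perm σ hw) h
  exact ⟨k j, c j, hkc j, hcoef j⟩

end WaringJennrich

end Summit.ValiantsHypothesis.ValiantsHypothesis.Theorems

end
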